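import Mathlib
import HarnessLib
import HarnessLib.Audit
import Summits.AtomisticToContinuum.Statement
import Summits.AtomisticToContinuum.BoseEinsteinCondensation.Theses.CondensateScaleLadder
import Summits.AtomisticToContinuum.BoseEinsteinCondensation.Theorems.CondensateScaleLadderHealingScaleCondensate
import HarnessLib.Audit.Status.Attr

/-!
Route: CoherentDoubling

# Route CoherentDoubling — Coherent doubling with gain — the residual R2B of the condensate scale
ladder carved along the quasi-order / genuine-order line, the sub-LRO piece outside every BEC
barrier

decomp-a2c NODE N_B.A.1 (lens 6 «barrier-complement carving», gen 6; conjunct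
BoseEinsteinCondensation; CHILD of route-AtomisticToContinuum-CondensateScaleLadder = tree node
N_B.A, refining its DECLARED RESIDUAL item GlobalFromUniform stmt-AtomisticToContinuum-26083
«scale-uniform local condensation ⇒ HasGroundStateBEC», the infrared half; the parent's attacked
items HealingScaleCondensate 26085 and UniformFromHealing 26084 are shared binders). Middle
statement DoublingAt v ρ («coherent doubling with gain»): there are c₀, η, ℓ₀ > 0 such that
eventually in N some tolerance δ_N > 0 forces every δ_N-near-minimiser of the Dirichlet energy in
the box of side L_N = (N/ρ)^(1/3) to satisfy, at EVERY scale ℓ₀ ≤ ℓ ≤ L_N/2 and for EVERY normalised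
one-body mode φ vanishing off a cube of side ≤ ℓ: some mode φ' vanishing off a cube of side ≤ 2ℓ has
occupation ≥ min(c₀ρ(2ℓ)³, (1+η)·occupation of φ) — the doubled cube either reaches the macroscopic
floor or carries STRICTLY MORE coherent occupation than it inherits from its best sub-cube (factor 1
is free; η > 0 excludes exactly the abrupt-fragmentation step «independent condensates in
neighbouring cubes»). It suffices to show X = DoublingFromUniform ∧ GlobalFromDoubling: A =
DoublingFromUniform (scale-uniform local condensation ⇒ DoublingAt; the barrier-complement piece)
and B = GlobalFromDoubling (scale-uniform local condensation ∧ DoublingAt ⇒ HasGroundStateBEC; the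
rigidity piece «quasi-condensate ⇒ condensate in d = 3», declared residual). Kernel (node file, 0
sorry): A → B → GlobalFromUniform; closes = the parent's closes; NECESSITY BEC → A (floor branch,
via the tiling lemma proved in the parent's V2 file, copied) and BEC → B; EXACTNESS
GlobalFromUniform ↔ A ∧ B and BEC ↔ R1 ∧ R12 ∧ A ∧ B, unconditional.
Lean:
`Summit.AtomisticToContinuum.BoseEinsteinCondensation.Theses.CoherentDoubling.DoublingFromUniform ∧
Summit.AtomisticToContinuum.BoseEinsteinCondensation.Theses.CoherentDoubling.GlobalFromDoubling`

## Assembly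
Pure logic (kernel-proved as `closes` in glue.lean, 0 sorry, through the parent's deciding theorem):
A and B compose to the parent's GlobalFromUniform (ρ₀ = min of the two thresholds; for ρ < ρ₀ and
scale-uniform local condensation, A gives DoublingAt, B gives HasGroundStateBEC), and
CondensateScaleLadder.closes turns HealingScaleCondensate, UniformFromHealing and GlobalFromUniform
into the conjunct.

Rationale: WHY THIS LINE. Every catalogued obstruction to BEC in the thermodynamic limit is an obstruction to
GENUINE long-range order or to a technique class: HohenbergLowDimension / PitaevskiiStringari1991
(dimension-insensitive estimates cannot give LRO because the d ≤ 2, resp. d = 1 ground-state,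
analogue fails), BogoliubovPerturbationInfrared (expansions about a c-number condensate diverge in
the infrared, Popov1983), KineticGapLengthScales (spectral gaps control only a ρ-coupled window of
scales), HalfFillingReflectionPositivity (the one LRO mechanism, KLS1988PRL / DysonLiebSimon1978,
needs a lattice at half filling), CasimirBoxGeneralizedCondensation and
EnergyAsymptoticsWithoutCondensation (occupation spread over many modes, resp. LHY-order energy,
does not see one macroscopic mode). The superfluid-theory taxonomy «topological (algebraic, quasi-)
order versus genuine order» ([galaxy:panama:442544840245299] Svistunov–Babaev–Prokof'ev §2.1.4 pp.
64–71; Cazalilla2004 §3.1 and Haldane1981 for the d = 1 Luttinger liquid, where the one-body density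
matrix decays like r^(−1/2K) and the occupation of the best mode in a window of length ℓ grows like
ℓ^(1−1/2K): MORE than incoherent inheritance, LESS than a condensate) says exactly where the
barrier-free statements live: below LRO strength. The node therefore carves the residual along that
line. Piece A is the profile-free, scale-by-scale form of Nozières' non-fragmentation principle
(Nozieres1995 §1 [corpus:book:griffin1995 pp. 19–22]: repulsion makes fragmentation cost exchange
energy; PethickSmith2008 §13.5.1 [corpus pp. 317–319] and MuellerEtAl2006 for spatially separated
fragments, where the cost is the Josephson coupling instead): its d = 1 analogue is TRUE, so no
dimension barrier can bite, it names no energy window, no expansion, no mode and no cycle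
statistics, and it tolerates generalized condensation. Piece B is the honest remainder: uniform
local condensation plus coherent doubling at every scale still allows an algebraic tail (iterating
the gain gives only occ(2^j ℓ₁) ≥ (1+η)^j cρℓ₁³), and excluding it is the d = 3 infrared-summability
content that every serious attack (Popov hydrodynamics, renormalised Bogoliubov theory Seiringer2011
/ FournaisSolovej2020, infrared bounds) is really about — now with a typed HYPOTHESIS (partial
coherence between all neighbouring scales) from which a coarse-grained phase field can be defined.
Imported: superfluid field theory (order taxonomy, with the explicit dictionary best-local-mode
occupation at scale ℓ ↔ ∫_(|x|<ℓ) γ(x,0)), Luttinger-liquid theory (the d = 1 witness that A is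
sub-LRO), nothing conjectural used as a fact. No existing BEC route types a sub-LRO NECESSARY
condition: BECDyadicChaining (closed: ≥ conjunct), BECHierarchicalRetention, BECScaleChaining /
BECHierarchicalGluing (retired) and BECIntegerBlockRotor state per-level SUMMABLE defect laws for
block-constant modes on the torus — LRO strength or transverse.

RANKED CRUXES. #2 DoublingFromUniform (crux) — piece A (barrier-complement). For every repulsive
finite-range v there is ρ₀ > 0 such that for all 0 < ρ < ρ₀: IF there is one constant c > 0 such
that at every fixed scale ℓ > 0, eventually in N, some tolerance δ > 0 forces every δ-near-minimiser
to have a normalised measurable mode vanishing off some cube of side ≤ ℓ with occupation ≥ cρℓ³ (the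
parent's scale-uniform local condensation), THEN DoublingAt v ρ: constants c₀, η, ℓ₀ > 0 with —
eventually in N, for some δ > 0, every δ-near-minimiser, every scale ℓ₀ ≤ ℓ ≤ L_N/2 and every
normalised mode φ off a cube of side ≤ ℓ — a normalised mode φ' off a cube of side ≤ 2ℓ with
occupation ≥ min(c₀ρ(2ℓ)³, (1+η)·occupation of φ). [difficulty: open-problem] (why it might fail:
near-minimisers at tolerance δ_N may fragment at a mesoscopic scale λ_N → ∞ into phase-independent
sub-condensates (ratio exactly 1 per doubling): the Josephson coupling ~ρ_s·λ_N per face is o(N) and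
no theorem yet converts exact minimality into inter-cube coherence.) [Nozieres1995,
PethickSmith2008, MuellerEtAl2006, Leggett2001, Cazalilla2004, Haldane1981, LSSY2005]
#3 GlobalFromDoubling (crux) — piece B (structural rigidity, declared residual). For every repulsive
finite-range v there is ρ₀ > 0 such that for all 0 < ρ < ρ₀: scale-uniform local condensation (as
above) AND DoublingAt v ρ (as above) together imply HasGroundStateBEC v ρ — a quasi-condensate with
uniform local condensation and coherent doubling at every scale up to L_N/2 is a condensate (no
algebraic tail in d = 3). [deps: DoublingFromUniform] [difficulty: open-problem] (why it might fail:
it is the infrared half: a 3D dilute ground state with uniform local condensation and algebraically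
decaying coherence (the Luttinger picture transplanted, gain 2^(3−a) per doubling) is excluded by no
theorem; the only rigorous LRO mechanism is reflection positivity on a lattice.)
[PitaevskiiStringari1991, Hohenberg1967, Popov1983, KLS1988PRL, DysonLiebSimon1978, Seiringer2011,
FournaisSolovej2020, Ceperley1995]
#4 UniformFromHealing (crux) — the parent's attacked item stmt-AtomisticToContinuum-26084, shared
binder (identical signature; dedup attaches this route): per (v,ρ), local condensation at SOME scale
with SOME constant ⇒ local condensation at EVERY fixed scale with ONE constant. [difficulty:
open-problem] (why it might fail: every rigorous localisation method loses a ρ-dependent power in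
the admissible box size (Junge2026: R ~ a(ρa³)^(-3/4-η) is optimal for the Neumann-localisation
operator); a scale-free constant needs an input outside the energy-window class.) [Fournais2020,
Junge2026, AdhikariBrenneckeSchlein2020, BrenneckeEtAl2024, FournaisSolovej2020]
#9 HealingScaleCondensate (support) — the parent's support item stmt-AtomisticToContinuum-26085,
shared binder (identical signature): per admissible v and small ρ, local condensation at ONE
N-independent scale with some constant — provable now from
`Literature.MathematicalPhysics.QuantumManyBody.BoseGas.floor_of_scatteringLength_pos` /
`floor_of_scatteringLength_zero` (M = 1, δ = 1) plus pigeonhole over the 8^k sub-cells (ℓ = 2/√ρ, c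
= 7/64). [difficulty: provable-now] [LSSY2005, LiebSeiringer2002]

TWO-LAYER PLAN. Registered BC3 skeletons (birth files, 2 stubs each, composition kernel-checked): A
⇐ stub_mesoscopicDoubling (gain-or-floor at all scales 2ℓ ≤ θ·L_N, every fraction θ ∈ (0,1]) →
stub_macroscopicDoubling (gain-or-floor on the last log₂(1/θ) doublings θ·L_N ≤ 2ℓ ≤ L_N, some θ <
1) → DoublingFromUniform (a lower cutoff ℓ ≥ Λ would be absorbed by ℓ₀, so the honest split is by
the upper end); B ⇐ stub_losslessFromGain (uniform local condensation ∧ some gain η > 0 ⇒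
ASYMPTOTICALLY LOSSLESS doubling-or-floor: ∀ε ∃ℓ_ε, gain ≥ 8(1−ε) beyond ℓ_ε — Bogoliubov's healing
of coherence with scale, no rate) → stub_condensateFromLossless (lossless doubling-or-floor ⇒
HasGroundStateBEC: no logarithmically slow decoherence, the summability step) → GlobalFromDoubling;
both B-stubs are again kernel-necessary for BEC through the floor branch. Nothing of this is filed
as items now.

KILL CRITERIA. A certified family of near-minimisers (some admissible v, ρ < ρ₀, N → ∞) with
scale-uniform local condensation whose best mode at scale 2ℓ carries no more than the best mode at
scale ℓ for ℓ in a range growing with N refutes DoublingFromUniform's consequent and — both pieces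
being necessary — BoseEinsteinCondensation itself (close --reason refuted:DoublingFromUniform;
negative knowledge for the summit); a proof that uniform local condensation and coherent doubling
coexist with λ_max(γ) = o(N) refutes GlobalFromDoubling and the conjunct. A proof of the parent's
GlobalFromUniform by any other means moots both pieces (close superseded --by the proving route).
HealingScaleCondensate cannot be refuted (it follows from proved theorems).

NOT DECOMPOSED YET. The mechanism for A (variational two-cube surgery at tolerance δ_N → 0:
re-cohering two fragmented sub-cubes should lower the energy by the Josephson term; or an a-priori
bound on the coarse-grained phase gradient), the mechanism for B (coarse-grained phase field defined
from the pairwise partial coherence that DoublingAt supplies, then d = 3 infrared summability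
Σ_(k≠0) 1/(k²L³)·L < ∞), the dependence of η on ρ (η → 7 as ρa³ → 0 expected), positive temperature,
and the tiling lemma (kept in the cell file as the necessity engine, not an item — not in the cone
of `closes`).

CHEAPEST FALSIFIER. T7c (extends the writer's T7a/T7b kit ask to census-1, same data, no new
simulation): from the PIGS/PIMC ground state of N = 128…512 Dirichlet hard spheres at ρa³ ∈ {1e-3,
1e-2} report the DOUBLING RATIOS g(ℓ) = max over positions of λ_max(γ restricted to a cube of side
2ℓ) divided by the same at side ℓ, for ℓ = ξ/2 … L/4. Bogoliubov theory predicts g(ℓ) = 8(1 −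
O(ξ²/ℓ²)) ↑ 8 (B-world); a plateau g ≈ 1 at some scale kills DoublingFromUniform (and BEC); a
constant g ∈ (1,8) would be the algebraic-tail world that GlobalFromDoubling must exclude. Not run
by this seat (kit not allowed); in-Lean checks done instead: necessity/exactness kernel proofs,
BC2/BC7 probes.

NUMBERS. Items at open: 5 (3 cruxes of which 1 shared with the parent, 1 shared provable support, 1
assembly). Necessity constants: c₀ = c/16, η = 1, ℓ₀ = 1 in `doublingAt_of_hasGroundStateBEC`; gain
per doubling is always ≤ 8 (tiling), = 2^(3−a) for an algebraic tail γ ~ r^(−a), = 1 for independent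
fragments; d = 1 Luttinger value 2^(1−1/2K) > 1 (Cazalilla2004 §3.1).

DEFINITION REQUESTS. None (DoublingAt, IsLocalMode, LocallyCondensed, ScaleUniformAt are node-file
abbreviations inlined verbatim in the items over existing BoseGas declarations).

Novelty: Searches (2026-08-30): tree `rg -i 'doubling|fragment|quasi-long|algebraic decay'
Summits/AtomisticToContinuum/BoseEinsteinCondensation/Theses` (BECPeriodDoubling = torus period
doubling of the k-mesh, unrelated; 'fragmented impostors' only in prose of BECLaplacianL1 /
BECNoCheapMomentum / BECRichardsonAnchor; no route states a one-step scale-doubling occupation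
inequality or any sub-LRO necessary condition); `ledger negatives --problem AtomisticToContinuum`
(24; BEC entries 14490 BerryStiffPhaseLRO, 3980 SwapJensen — neither a local-coherence statement);
corpus `lit search --hybrid "quasicondensate fragmented condensate three dimensions ground state
long-range order"` (8 docs) → [corpus:book:griffin1995-bose-einstein-condensation pp. 19–22]
Nozières 1995 §1 «Fragmentation of the condensate» (exchange energy makes fragmentation costly),
[corpus:book:pethick2008-boseeinstein-condensation-dilute-gases pp. 317–319] §13.5.1 «Fragmented
condensates» (two far-apart wells: the B ∧ ¬A separating picture; Fock term favours one condensate),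
[corpus:book:lieb2005-mathematics-bose-gas-its-condensation pp. 114, 166]; `lit vsearch
"…algebraically decaying one-body density matrix but no BEC in three dimensions"` (8 docs, same
books + griffin1993); galaxy `lit galaxy search "fragmented condensate|fragmentation of
Bose|quasicondensate" --star all` (20 rows) → [galaxy:panama:442544840245299 pp. 64–71]
Svistunov–Babaev–Prokof'ev «Topological versus genuine long-range order» (power-law decay of  [refs: book:griffin1995-bose-einstein-condensation, book:pethick2008-boseeinstein-condensation-dilute-gases, book:lieb2005-mathematics-bose-gas-its-condensation, Nozieres1995, MuellerEtAl2006, Cazalilla2004]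

Barriers (technique_class: residual-carving, fragmentation-exclusion, multiscale): - technique_class: residual-carving, fragmentation-exclusion, multiscale
- Literature.Barriers.AtomisticToContinuum.KineticGapLengthScales: (with
KineticGapLengthScalesNarrow `exists_decondensed_within_gap`, `energyWindow_fraction_le_half`;
mode-free Dirichlet companion `BoseGas.not_dirichletBEC_modeFree_window`) the class «spectral gap of
a box below the ρ-coupled window ⇒ condensation» — DoublingFromUniform names no window and no gap:
it quantifies over ALL scales up to L_N/2 in the thermodynamic box and compares neighbouring scales
only, in the ∃δ_N near-minimiser frame that the cat-state witness does not reach (outside by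
hypothesis); UniformFromHealing is the parent's declared inside-the-class-from-above crux;
HealingScaleCondensate is proved inside the class.
- Literature.Barriers.AtomisticToContinuum.KineticGapLengthScalesNarrow: as above — every WINDOWED
reading «energy ≤ E₀ + w_N with a super-gap window ⇒ λ_max ≥ cN» is false at v = 0; all pieces keep
∃δ (tolerance chosen after N), and at v = 0 DoublingAt holds with gain 8 (free Dirichlet ground
state fully condensed), so the Galilei-boost / cat-state witnesses are not instances.
- Literature.Barriers.AtomisticToContinuum.BogoliubovPerturbationInfrared: bites proofs of
GlobalFromDoubling by expansion about a c-number condensate (declared: B sits inside, residual);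
DoublingFromUniform asserts no expansion and no rate — an O(1)-slack inequality between two
neighbouring scales, to be attacked variationally (two-cube sur

sub-problem: BoseEinsteinCondensation · status: draft · opened planner-decomp-a2c-lens-6-g6-0 2026-08-30T06:06:23Z · rev 0 · ledger route-AtomisticToContinuum-CoherentDoubling
GENERATED by the gate from the ledger (D-0016/17). Provers cite these decls: `theorem foo : Summit.AtomisticToContinuum.BoseEinsteinCondensation.Theses.CoherentDoubling.<Decl> := …` in Summits/AtomisticToContinuum/BoseEinsteinCondensation/Theorems/<Name>.lean.
-/

namespace Summit.AtomisticToContinuum.BoseEinsteinCondensation.Theses.CoherentDoubling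

open scoped BigOperators Topology Manifold Classical MeasureTheory ProbabilityTheory Matrix InnerProductSpace ComplexConjugate ContinuousMap
open Filter Set Function TopologicalSpace MeasureTheory

attribute [summit_statement] _root_.BoseEinsteinCondensation

/-- item stmt-AtomisticToContinuum-29045 · crux · rank 2 · open · by planner
why it might fail: near-minimisers at tolerance δ_N may fragment at a mesoscopic scale λ_N → ∞ into phase-independent sub-condensates (ratio exactly 1 per doubling): the Josephson coupling ~ρ_s·λ_N per face is o(N) and no theorem yet converts exact minimality into inter-cube coherence.
sources: Nozieres1995, PethickSmith2008, MuellerEtAl2006, Leggett2001, Cazalilla2004, Haldane1981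
[crux] piece A (barrier-complement). For every repulsive finite-range v there is ρ₀ > 0 such that
for all 0 < ρ < ρ₀: IF there is one constant c > 0 such that at every fixed scale ℓ > 0, eventually
in N, some tolerance δ > 0 forces every δ-near-minimiser to have a normalised measurable mode
vanishing off some cube of side ≤ ℓ with occupation ≥ cρℓ³ (the parent's scale-uniform local
condensation), THEN DoublingAt v ρ: constants c₀, η, ℓ₀ > 0 with — eventually in N, for some δ > 0,
every δ-near-minimiser, every scale ℓ₀ ≤ ℓ ≤ L_N/2 and every normalised mode φ off a cube of side ≤
ℓ — a normalised mode φ' off a cube of side ≤ 2ℓ with occupation ≥ min(c₀ρ(2ℓ)³, (1+η)·occupation of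
φ). [difficulty: open-problem] -/
@[route_item "route-AtomisticToContinuum-CoherentDoubling", crux]
def DoublingFromUniform : Prop :=
  ∀ v : ℝ → ENNReal, Literature.MathematicalPhysics.QuantumManyBody.BoseGas.IsRepulsiveFiniteRange v → ∃ ρ₀ : ℝ, 0 < ρ₀ ∧ ∀ ρ : ℝ, 0 < ρ → ρ < ρ₀ → (∃ c : ℝ, 0 < c ∧ ∀ ℓ : ℝ, 0 < ℓ → ∀ᶠ N : ℕ in Filter.atTop, ∃ δ : ENNReal, 0 < δ ∧ ∀ Ψ : Literature.MathematicalPhysics.QuantumManyBody.BoseGas.TrialState N (Literature.MathematicalPhysics.QuantumManyBody.BoseGas.sideLength ρ N), Literature.MathematicalPhysics.QuantumManyBody.BoseGas.energy v Ψ ≤ Literature.MathematicalPhysics.QuantumManyBody.BoseGas.groundStateEnergy v N (Literature.MathematicalPhysics.QuantumManyBody.BoseGas.sideLength ρ N) + δ → ∃ φ : EuclideanSpace ℝ (Fin 3) → ℂ, (MeasureTheory.AEStronglyMeasurable φ MeasureTheory.volume ∧ (∫⁻ x, (‖φ x‖₊ : ENNReal) ^ 2) = 1 ∧ ∃ (a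 : EuclideanSpace ℝ (Fin 3)) (s : ℝ), 0 < s ∧ s ≤ ℓ ∧ ∀ x : EuclideanSpace ℝ (Fin 3), (∃ i : Fin 3, x i < a i ∨ a i + s ≤ x i) → φ x = 0) ∧ ENNReal.ofReal (c * ρ * ℓ ^ 3) ≤ Literature.MathematicalPhysics.QuantumManyBody.BoseGas.occupation N φ Ψ.ψ) → ∃ c₀ : ℝ, 0 < c₀ ∧ ∃ η : ℝ, 0 < η ∧ ∃ ℓ₀ : ℝ, 0 < ℓ₀ ∧ ∀ᶠ N : ℕ in Filter.atTop, ∃ δ : ENNReal, 0 < δ ∧ ∀ Ψ : Literature.MathematicalPhysics.QuantumManyBody.BoseGas.TrialState N (Literature.MathematicalPhysics.QuantumManyBody.BoseGas.sideLength ρ N), Literature.MathematicalPhysics.QuantumManyBody.BoseGas.energy v Ψ ≤ Literature.MathematicalPhysics.QuantumManyBody.BoseGas.groundStateEnergy v N (Literature.MathematicalPhysics.QuantumManyBody.BoseGas.sideLength ρ N) + δ → ∀ ℓ : ℝ, ℓ₀ ≤ ℓ → 2 * ℓ ≤ Literature.MathematicalPhysics.QuantumManyBody.BoseGas.sideLength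 ρ N → ∀ φ : EuclideanSpace ℝ (Fin 3) → ℂ, (MeasureTheory.AEStronglyMeasurable φ MeasureTheory.volume ∧ (∫⁻ x, (‖φ x‖₊ : ENNReal) ^ 2) = 1 ∧ ∃ (a : EuclideanSpace ℝ (Fin 3)) (s : ℝ), 0 < s ∧ s ≤ ℓ ∧ ∀ x : EuclideanSpace ℝ (Fin 3), (∃ i : Fin 3, x i < a i ∨ a i + s ≤ x i) → φ x = 0) → ∃ φ' : EuclideanSpace ℝ (Fin 3) → ℂ, (MeasureTheory.AEStronglyMeasurable φ' MeasureTheory.volume ∧ (∫⁻ x, (‖φ' x‖₊ : ENNReal) ^ 2) = 1 ∧ ∃ (a : EuclideanSpace ℝ (Fin 3)) (s : ℝ), 0 < s ∧ s ≤ 2 * ℓ ∧ ∀ x : EuclideanSpace ℝ (Fin 3), (∃ i : Fin 3, x i < a i ∨ a i + s ≤ x i) → φ' x = 0) ∧ min (ENNReal.ofReal (c₀ * ρ * (2 * ℓ) ^ 3)) ((1 + ENNReal.ofReal η) * Literature.MathematicalPhysics.QuantumManyBody.BoseGas.occupation N φ Ψ.ψ) ≤ Literature.MathematicalPhysics.QuantumManyBody.BoseGas.occupation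 N φ' Ψ.ψ

/-- item stmt-AtomisticToContinuum-29046 · crux · rank 3 · open · by planner
why it might fail: it is the infrared half: a 3D dilute ground state with uniform local condensation and algebraically decaying coherence (the Luttinger picture transplanted, gain 2^(3−a) per doubling) is excluded by no theorem; the only rigorous LRO mechanism is reflection positivity on a lattice.
sources: PitaevskiiStringari1991, Hohenberg1967, Popov1983, KLS1988PRL, DysonLiebSimon1978, Seiringer2011
[crux] piece B (structural rigidity, declared residual). For every repulsive finite-range v there is
ρ₀ > 0 such that for all 0 < ρ < ρ₀: scale-uniform local condensation (as above) AND DoublingAt v ρ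
(as above) together imply HasGroundStateBEC v ρ — a quasi-condensate with uniform local condensation
and coherent doubling at every scale up to L_N/2 is a condensate (no algebraic tail in d = 3).
[deps: DoublingFromUniform] [difficulty: open-problem] -/
@[route_item "route-AtomisticToContinuum-CoherentDoubling", crux]
def GlobalFromDoubling : Prop :=
  ∀ v : ℝ → ENNReal, Literature.MathematicalPhysics.QuantumManyBody.BoseGas.IsRepulsiveFiniteRange v → ∃ ρ₀ : ℝ, 0 < ρ₀ ∧ ∀ ρ : ℝ, 0 < ρ → ρ < ρ₀ → (∃ c : ℝ, 0 < c ∧ ∀ ℓ : ℝ, 0 < ℓ → ∀ᶠ N : ℕ in Filter.atTop, ∃ δ : ENNReal, 0 < δ ∧ ∀ Ψ : Literature.MathematicalPhysics.QuantumManyBody.BoseGas.TrialState N (Literature.MathematicalPhysics.QuantumManyBody.BoseGas.sideLength ρ N), Literature.MathematicalPhysics.QuantumManyBody.BoseGas.energy v Ψ ≤ Literature.MathematicalPhysics.QuantumManyBody.BoseGas.groundStateEnergy v N (Literature.MathematicalPhysics.QuantumManyBody.BoseGas.sideLength ρ N) + δ → ∃ φ : EuclideanSpace ℝ (Fin 3)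 → ℂ, (MeasureTheory.AEStronglyMeasurable φ MeasureTheory.volume ∧ (∫⁻ x, (‖φ x‖₊ : ENNReal) ^ 2) = 1 ∧ ∃ (a : EuclideanSpace ℝ (Fin 3)) (s : ℝ), 0 < s ∧ s ≤ ℓ ∧ ∀ x : EuclideanSpace ℝ (Fin 3), (∃ i : Fin 3, x i < a i ∨ a i + s ≤ x i) → φ x = 0) ∧ ENNReal.ofReal (c * ρ * ℓ ^ 3) ≤ Literature.MathematicalPhysics.QuantumManyBody.BoseGas.occupation N φ Ψ.ψ) → (∃ c₀ : ℝ, 0 < c₀ ∧ ∃ η : ℝ, 0 < η ∧ ∃ ℓ₀ : ℝ, 0 < ℓ₀ ∧ ∀ᶠ N : ℕ in Filter.atTop, ∃ δ : ENNReal, 0 < δ ∧ ∀ Ψ : Literature.MathematicalPhysics.QuantumManyBody.BoseGas.TrialState N (Literature.MathematicalPhysics.QuantumManyBody.BoseGas.sideLength ρ N), Literature.MathematicalPhysics.QuantumManyBody.BoseGas.energy v Ψ ≤ Literature.MathematicalPhysics.QuantumManyBody.BoseGas.groundStateEnergy v N (Literature.MathematicalPhysics.QuantumManyBody.BoseGas.sideLength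 ρ N) + δ → ∀ ℓ : ℝ, ℓ₀ ≤ ℓ → 2 * ℓ ≤ Literature.MathematicalPhysics.QuantumManyBody.BoseGas.sideLength ρ N → ∀ φ : EuclideanSpace ℝ (Fin 3) → ℂ, (MeasureTheory.AEStronglyMeasurable φ MeasureTheory.volume ∧ (∫⁻ x, (‖φ x‖₊ : ENNReal) ^ 2) = 1 ∧ ∃ (a : EuclideanSpace ℝ (Fin 3)) (s : ℝ), 0 < s ∧ s ≤ ℓ ∧ ∀ x : EuclideanSpace ℝ (Fin 3), (∃ i : Fin 3, x i < a i ∨ a i + s ≤ x i) → φ x = 0) → ∃ φ' : EuclideanSpace ℝ (Fin 3) → ℂ, (MeasureTheory.AEStronglyMeasurable φ' MeasureTheory.volume ∧ (∫⁻ x, (‖φ' x‖₊ : ENNReal) ^ 2) = 1 ∧ ∃ (a : EuclideanSpace ℝ (Fin 3)) (s : ℝ), 0 < s ∧ s ≤ 2 * ℓ ∧ ∀ x : EuclideanSpace ℝ (Fin 3), (∃ i : Fin 3, x i < a i ∨ a i + s ≤ x i) → φ' x = 0) ∧ min (ENNReal.ofReal (c₀ * ρ * (2 * ℓ) ^ 3))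 ((1 + ENNReal.ofReal η) * Literature.MathematicalPhysics.QuantumManyBody.BoseGas.occupation N φ Ψ.ψ) ≤ Literature.MathematicalPhysics.QuantumManyBody.BoseGas.occupation N φ' Ψ.ψ) → Literature.MathematicalPhysics.QuantumManyBody.BoseGas.HasGroundStateBEC v ρ

/-- item stmt-AtomisticToContinuum-26084 · crux · rank 4 · open · by planner
why it might fail: every rigorous localisation method loses a ρ-dependent power in the admissible box size (Junge2026: R ~ a(ρa³)^(-3/4-η) is optimal for the Neumann-localisation operator); a scale-free constant needs an input outside the energy-window class.
sources: Fournais2020, Junge2026, AdhikariBrenneckeSchlein2020, BrenneckeEtAl2024, FournaisSolovej2020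
[crux] for every repulsive finite-range v there is ρ₀ > 0 such that for all 0 < ρ < ρ₀: IF the
ground state is locally condensed at SOME scale ℓ₀ with SOME constant (eventually in N, a tolerance
δ > 0 forces every δ-near-minimiser to have a normalised mode in some cube of side ≤ ℓ₀ with
occupation ≥ c₀·ρ·ℓ₀³), THEN there is ONE constant c > 0 such that the same holds at EVERY fixed
scale ℓ > 0 with occupation ≥ c·ρ·ℓ³ (the depletion is intensive: uniform in the scale, not only
inside the kinetic-gap window ℓ ≲ const·(ρa)^(-1/2)). PIECE TAG WEAKER (necessity kernel modulo the
elementary tiling lemma: `uniformFromHealing_of_bec`). LEAF IDEA-NEEDED + BARRIER-adjacent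
(KineticGapLengthScales / KineticGapLengthScalesNarrow: energy-window localisation reaches only
scales (ρa³)^(-power)·ξ with the box coupled to ρ — Fournais2020, Junge2026; the statement asks ℓ
fixed but arbitrary at fixed ρ) + INSTRUMENTABLE (T7a: max over positions of the top eigenvalue of γ
restricted to sub-cubes of side ℓ, divided by ρℓ³, vs ℓ/ξ — plateau test, PIGS/DMC ground state of
Dirichlet hard spheres at ρa³ ∈ {1e-4,1e-3,1e-2}). ATTACKED piece. [difficulty: open-problem] -/
@[route_item "route-AtomisticToContinuum-CoherentDoubling", crux]
def UniformFromHealing : Prop :=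
  ∀ v : ℝ → ENNReal, Literature.MathematicalPhysics.QuantumManyBody.BoseGas.IsRepulsiveFiniteRange v → ∃ ρ₀ : ℝ, 0 < ρ₀ ∧ ∀ ρ : ℝ, 0 < ρ → ρ < ρ₀ → (∃ ℓ : ℝ, 0 < ℓ ∧ ∃ c : ℝ, 0 < c ∧ ∀ᶠ N : ℕ in Filter.atTop, ∃ δ : ENNReal, 0 < δ ∧ ∀ Ψ : Literature.MathematicalPhysics.QuantumManyBody.BoseGas.TrialState N (Literature.MathematicalPhysics.QuantumManyBody.BoseGas.sideLength ρ N), Literature.MathematicalPhysics.QuantumManyBody.BoseGas.energy v Ψ ≤ Literature.MathematicalPhysics.QuantumManyBody.BoseGas.groundStateEnergy v N (Literature.MathematicalPhysics.QuantumManyBody.BoseGas.sideLength ρ N) + δ → ∃ φ : EuclideanSpace ℝ (Fin 3) → ℂ, (MeasureTheory.AEStronglyMeasurable φ MeasureTheory.volume ∧ (∫⁻ x, (‖φ x‖₊ : ENNReal) ^ 2) = 1 ∧ ∃ (a : EuclideanSpace ℝ (Fin 3)) (s : ℝ), 0 < s ∧ s ≤ ℓ ∧ ∀ x : EuclideanSpace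 ℝ (Fin 3), (∃ i : Fin 3, x i < a i ∨ a i + s ≤ x i) → φ x = 0) ∧ ENNReal.ofReal (c * ρ * ℓ ^ 3) ≤ Literature.MathematicalPhysics.QuantumManyBody.BoseGas.occupation N φ Ψ.ψ) → ∃ c : ℝ, 0 < c ∧ ∀ ℓ : ℝ, 0 < ℓ → ∀ᶠ N : ℕ in Filter.atTop, ∃ δ : ENNReal, 0 < δ ∧ ∀ Ψ : Literature.MathematicalPhysics.QuantumManyBody.BoseGas.TrialState N (Literature.MathematicalPhysics.QuantumManyBody.BoseGas.sideLength ρ N), Literature.MathematicalPhysics.QuantumManyBody.BoseGas.energy v Ψ ≤ Literature.MathematicalPhysics.QuantumManyBody.BoseGas.groundStateEnergy v N (Literature.MathematicalPhysics.QuantumManyBody.BoseGas.sideLength ρ N) + δ → ∃ φ : EuclideanSpace ℝ (Fin 3) → ℂ, (MeasureTheory.AEStronglyMeasurable φ MeasureTheory.volume ∧ (∫⁻ x, (‖φ x‖₊ : ENNReal) ^ 2) = 1 ∧ ∃ (a : EuclideanSpace ℝ (Fin 3)) (s : ℝ), 0 < s ∧ s ≤ ℓ ∧ ∀ x : EuclideanSpace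 ℝ (Fin 3), (∃ i : Fin 3, x i < a i ∨ a i + s ≤ x i) → φ x = 0) ∧ ENNReal.ofReal (c * ρ * ℓ ^ 3) ≤ Literature.MathematicalPhysics.QuantumManyBody.BoseGas.occupation N φ Ψ.ψ

/-- item stmt-AtomisticToContinuum-26085 · support · rank 9 · closed · proved by Summit.AtomisticToContinuum.BoseEinsteinCondensation.Theses.CondensateScaleLadder.healingScaleCondensate_proof (prover) · by planner
sources: LSSY2005, LiebSeiringer2002
[support] for every repulsive finite-range v there is ρ₀ > 0 such that for all 0 < ρ < ρ₀ there are
ONE scale ℓ > 0 and c > 0 with: eventually in N, some tolerance δ > 0 forces every δ-near-minimiser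
of the Dirichlet energy in the box of side (N/ρ)^(1/3) to have a normalised measurable one-body mode
vanishing off some coordinate cube of side ≤ ℓ with occupation ≥ c·ρ·ℓ³. PIECE TAG WEAKER (necessity
kernel modulo tiling: `healingScaleCondensate_of_bec`) and PROVABLE NOW (ATTACKABLE-S):
`floor_of_scatteringLength_pos` / `floor_of_scatteringLength_zero`
(BoseGasSubcellCondensationDilute.lean, proved) with M = 1, δ = 1, plus pigeonhole over the 8^k
sub-cells (`exists_sum_le_card_mul`) and `subMode_eq_indicator` give ℓ = 2/√ρ, c = 7/64.
[difficulty: provable-now] -/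
@[route_item "route-AtomisticToContinuum-CoherentDoubling", crux]
def HealingScaleCondensate : Prop :=
  ∀ v : ℝ → ENNReal, Literature.MathematicalPhysics.QuantumManyBody.BoseGas.IsRepulsiveFiniteRange v → ∃ ρ₀ : ℝ, 0 < ρ₀ ∧ ∀ ρ : ℝ, 0 < ρ → ρ < ρ₀ → ∃ ℓ : ℝ, 0 < ℓ ∧ ∃ c : ℝ, 0 < c ∧ ∀ᶠ N : ℕ in Filter.atTop, ∃ δ : ENNReal, 0 < δ ∧ ∀ Ψ : Literature.MathematicalPhysics.QuantumManyBody.BoseGas.TrialState N (Literature.MathematicalPhysics.QuantumManyBody.BoseGas.sideLength ρ N), Literature.MathematicalPhysics.QuantumManyBody.BoseGas.energy v Ψ ≤ Literature.MathematicalPhysics.QuantumManyBody.BoseGas.groundStateEnergy v N (Literature.MathematicalPhysics.QuantumManyBody.BoseGas.sideLength ρ N) + δ → ∃ φ : EuclideanSpace ℝ (Fin 3) → ℂ, (MeasureTheory.AEStronglyMeasurable φ MeasureTheory.volume ∧ (∫⁻ x, (‖φ x‖₊ : ENNReal) ^ 2) = 1 ∧ ∃ (a : EuclideanSpace ℝ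 (Fin 3)) (s : ℝ), 0 < s ∧ s ≤ ℓ ∧ ∀ x : EuclideanSpace ℝ (Fin 3), (∃ i : Fin 3, x i < a i ∨ a i + s ≤ x i) → φ x = 0) ∧ ENNReal.ofReal (c * ρ * ℓ ^ 3) ≤ Literature.MathematicalPhysics.QuantumManyBody.BoseGas.occupation N φ Ψ.ψ

/-- `HealingScaleCondensate` holds: proved by `Summit.AtomisticToContinuum.BoseEinsteinCondensation.Theses.CondensateScaleLadder.healingScaleCondensate_proof`. -/
theorem HealingScaleCondensate_holds : HealingScaleCondensate := _root_.Summit.AtomisticToContinuum.BoseEinsteinCondensation.Theses.CondensateScaleLadder.healingScaleCondensate_proof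

/-- item stmt-AtomisticToContinuum-29047 · assembly · rank 1 · open · by planner
sources: LSSY2005
[assembly] HealingScaleCondensate → UniformFromHealing → DoublingFromUniform → GlobalFromDoubling →
BoseEinsteinCondensation. -/
@[route_item "route-AtomisticToContinuum-CoherentDoubling"]
def Assembly : Prop :=
  HealingScaleCondensate → UniformFromHealing → DoublingFromUniform → GlobalFromDoubling → _root_.BoseEinsteinCondensation

/-! D-0027 §2.1 — DECIDING THEOREM (planner-authored via `route open/edit --closes-file`; by planner-decomp-a2c-lens-6-g6-0 2026-08-30T06:06:23Z):
its hypotheses are this route's items and its conclusion the sub-problem Statement (glue_lint), and it elaborates with this file. -/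

@[closes "route-AtomisticToContinuum-CoherentDoubling"] theorem closes (h₁ : HealingScaleCondensate) (h₂ : UniformFromHealing) (h₃ : DoublingFromUniform)
    (h₄ : GlobalFromDoubling) : _root_.BoseEinsteinCondensation := by
  -- the split of the parent's residual: A → B → GlobalFromUniform (ρ₀ = min of the two thresholds)
  have hR : Summit.AtomisticToContinuum.BoseEinsteinCondensation.Theses.CondensateScaleLadder.GlobalFromUniform := by
    intro v hv
    obtain ⟨ρ₁, hρ₁, H₁⟩ := h₃ v hv
    obtain ⟨ρ₂, hρ₂, H₂⟩ := h₄ v hv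
    refine ⟨min ρ₁ ρ₂, lt_min hρ₁ hρ₂, fun ρ hρ hρlt hU => ?_⟩
    exact H₂ ρ hρ (lt_of_lt_of_le hρlt (min_le_right _ _)) hU
      (H₁ ρ hρ (lt_of_lt_of_le hρlt (min_le_left _ _)) hU)
  -- the parent's deciding theorem (shared binders h₁ h₂ are the parent's items verbatim)
  exact Summit.AtomisticToContinuum.BoseEinsteinCondensation.Theses.CondensateScaleLadder.closes h₁ h₂ hR

end Summit.AtomisticToContinuum.BoseEinsteinCondensation.Theses.CoherentDoubling
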